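import Mathlib
import Summits.QuantumFields.YangMills.Theorems.ScalingWindowSplitSelfNormalisedSkewnessStubTorusLatticeSums
import Summits.QuantumFields.YangMills.Theorems.ScalingWindowSplitSelfNormalisedSkewnessStubFlatPairSum
import HarnessLib

/-!
# Crux `SelfNormalisedSkewness` (stmt-QuantumFields-18944), line `Sketch`, stub `stub_ringSmearingBound`:
# one group of the smeared odd ring

Helper file for the stub `stub_ringSmearingBound` (the smeared odd ring of lattice propagators is
`O(a log S)` for disjointly supported Schwartz triples). The ring bound splits into three groups, each
of the shape `(d(x̄-ȳ)⁻⁵ + S⁻⁴) d(ȳ-z̄)⁻⁴ d(z̄-x̄)⁻⁴` up to a cyclic relabelling; here we bound ONE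
group (`ringSmearing_group_bound`):

* torus geometry in centred coordinates: `d(-w) = d(w)`, the squared triangle inequality
  `d(u+v)² ≤ 2(d(u)² + d(v)²)` and its consequence `d(u)⁻⁴ d(v)⁻⁴ ≤ 16 d(u+v)⁻⁴ (d(u)⁻⁴ + d(v)⁻⁴)`;
  distinct points of `box 4 L` stay distinct on the torus of side `2L+1`;
* the sum over the third point costs `d(x̄-ȳ)⁻⁴ · O(∑_{w≠0} d(w)⁻⁴)` (`ringSmearing_third_point_sum_le`),
  leaving the flat pair sum with `d⁻⁹` (`stub_flatPairSum`, `O(a)`) and a zero-mode term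
  `S⁻⁴ · O(a⁻⁴ log² S) = O(a⁴ log² S)`; the lattice sums are `stub_torusLatticeSums`.

Everything here is folklore bookkeeping; no named facts are used.
-/

noncomputable section

open scoped BigOperators
open Literature.MathematicalPhysics.QuantumLattice (siteToE siteToE_apply)
open Literature.Probability.LatticeModels (Site TorusSite Torus.proj Torus.proj_apply box mem_box)

namespace Summit.QuantumFields.YangMills.Theorems.SelfNormalisedSkewness.Negative

/-! ### Torus geometry in centred coordinates -/

/-- Distinct points of `box 4 L` have distinct images on the torus of side `2L+1`. [folklore] -/
theorem proj_sub_proj_ne_zero_of_mem_box {L : ℕ} {x y : Site 4} (hx : x ∈ box 4 L)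
    (hy : y ∈ box 4 L) (hxy : x ≠ y) : Torus.proj (2 * L + 1) x - Torus.proj (2 * L + 1) y ≠ 0 := by
  intro h
  apply hxy
  funext i
  have hi : (Torus.proj (2 * L + 1) x - Torus.proj (2 * L + 1) y) i = 0 := by rw [h]; rfl
  rw [Pi.sub_apply, Torus.proj_apply, Torus.proj_apply, sub_eq_zero, eq_comm,
    ZMod.intCast_eq_intCast_iff_dvd_sub] at hi
  have hxi := (mem_box.1 hx) i
  have hyi := (mem_box.1 hy) i
  have habs : |x i - y i| < ((2 * L + 1 : ℕ) : ℤ) := by rw [abs_lt]; push_cast; omega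
  have h0 := Int.eq_zero_of_abs_lt_dvd hi habs
  omega

/-- The torus distance `d(w) = √(∑_μ valMinAbs(w μ)²)` is even: `d(-w) = d(w)`. [folklore] -/
theorem sqrt_sum_sq_valMinAbs_neg {S : ℕ} (w : TorusSite 4 S) :
    Real.sqrt (∑ μ, ((((-w) μ).valMinAbs : ℤ) : ℝ) ^ 2) =
      Real.sqrt (∑ μ, (((w μ).valMinAbs : ℤ) : ℝ) ^ 2) := by
  congr 1
  refine Finset.sum_congr rfl fun μ _ => ?_
  have h : ((-w) μ).valMinAbs ^ 2 = ((w μ).valMinAbs) ^ 2 := by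
    rw [Pi.neg_apply, ← Int.natAbs_eq_iff_sq_eq]
    exact ZMod.natAbs_valMinAbs_neg (w μ)
  exact_mod_cast h

/-- Squared triangle inequality for the torus distance: `d(u+v)² ≤ 2 (d(u)² + d(v)²)`
(coordinatewise `|valMinAbs(a+b)| ≤ |valMinAbs a + valMinAbs b|`). [folklore] -/
theorem sum_sq_valMinAbs_add_le {S : ℕ} (u v : TorusSite 4 S) :
    ∑ μ, ((((u + v) μ).valMinAbs : ℤ) : ℝ) ^ 2 ≤
      2 * (∑ μ, (((u μ).valMinAbs : ℤ) : ℝ) ^ 2 + ∑ μ, (((v μ).valMinAbs : ℤ) : ℝ) ^ 2) := by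
  rw [← Finset.sum_add_distrib, Finset.mul_sum]
  refine Finset.sum_le_sum fun μ _ => ?_
  have h1 : ((u + v) μ).valMinAbs ^ 2 ≤ ((u μ).valMinAbs + (v μ).valMinAbs) ^ 2 := by
    rw [Pi.add_apply, ← Int.natAbs_le_iff_sq_le]
    exact ZMod.natAbs_valMinAbs_add_le (u μ) (v μ)
  have h2 : ((((u + v) μ).valMinAbs : ℤ) : ℝ) ^ 2 ≤
      ((((u μ).valMinAbs : ℤ) : ℝ) + (((v μ).valMinAbs : ℤ) : ℝ)) ^ 2 := by exact_mod_cast h1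
  nlinarith [sq_nonneg ((((u μ).valMinAbs : ℤ) : ℝ) - (((v μ).valMinAbs : ℤ) : ℝ))]

/-- If `d(u) ≤ d(v)` and `u + v ≠ 0` then `d(v)⁻¹ ≤ 2 d(u+v)⁻¹` (as `d(u+v) ≤ 2 d(v)`). [folklore] -/
theorem inv_torusDist_le_two_mul_inv_add {S : ℕ} (u v : TorusSite 4 S) (huv : u + v ≠ 0)
    (hle : Real.sqrt (∑ μ, (((u μ).valMinAbs : ℤ) : ℝ) ^ 2) ≤
      Real.sqrt (∑ μ, (((v μ).valMinAbs : ℤ) : ℝ) ^ 2)) :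
    (Real.sqrt (∑ μ, (((v μ).valMinAbs : ℤ) : ℝ) ^ 2))⁻¹ ≤
      2 * (Real.sqrt (∑ μ, ((((u + v) μ).valMinAbs : ℤ) : ℝ) ^ 2))⁻¹ := by
  have h1 := one_le_torusDist huv
  have hsq := sum_sq_valMinAbs_add_le u v
  set A := ∑ μ, (((u μ).valMinAbs : ℤ) : ℝ) ^ 2
  set Bv := ∑ μ, (((v μ).valMinAbs : ℤ) : ℝ) ^ 2
  set Cw := ∑ μ, ((((u + v) μ).valMinAbs : ℤ) : ℝ) ^ 2
  have hA0 : 0 ≤ A := Finset.sum_nonneg fun _ _ => sq_nonneg _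
  have hB0 : 0 ≤ Bv := Finset.sum_nonneg fun _ _ => sq_nonneg _
  have hAB : A ≤ Bv := by
    calc A = (Real.sqrt A) ^ 2 := (Real.sq_sqrt hA0).symm
      _ ≤ (Real.sqrt Bv) ^ 2 := pow_le_pow_left₀ (Real.sqrt_nonneg _) hle 2
      _ = Bv := Real.sq_sqrt hB0
  have hCB : Real.sqrt Cw ≤ 2 * Real.sqrt Bv := by
    calc Real.sqrt Cw ≤ Real.sqrt (4 * Bv) := Real.sqrt_le_sqrt (by linarith)
      _ = Real.sqrt 4 * Real.sqrt Bv := Real.sqrt_mul (by norm_num) _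
      _ = 2 * Real.sqrt Bv := by
          rw [show (4 : ℝ) = 2 ^ 2 by norm_num, Real.sqrt_sq (by norm_num)]
  have hCpos : 0 < Real.sqrt Cw := one_pos.trans_le h1
  rw [show 2 * (Real.sqrt Cw)⁻¹ = (Real.sqrt Cw / 2)⁻¹ by rw [inv_div]; ring]
  exact inv_anti₀ (by positivity) (by linarith)

/-- **Key geometric inequality**: `d(u)⁻⁴ d(v)⁻⁴ ≤ 16 d(u+v)⁻⁴ (d(u)⁻⁴ + d(v)⁻⁴)` for
`u + v ≠ 0` (the larger of `d(u), d(v)` is at least `d(u+v)/2`). [folklore] -/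
theorem torusDist_inv_pow_four_mul_le {S : ℕ} (u v : TorusSite 4 S) (huv : u + v ≠ 0) :
    (Real.sqrt (∑ μ, (((u μ).valMinAbs : ℤ) : ℝ) ^ 2))⁻¹ ^ 4 *
        (Real.sqrt (∑ μ, (((v μ).valMinAbs : ℤ) : ℝ) ^ 2))⁻¹ ^ 4 ≤
      16 * (Real.sqrt (∑ μ, ((((u + v) μ).valMinAbs : ℤ) : ℝ) ^ 2))⁻¹ ^ 4 *
        ((Real.sqrt (∑ μ, (((u μ).valMinAbs : ℤ) : ℝ) ^ 2))⁻¹ ^ 4 +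
          (Real.sqrt (∑ μ, (((v μ).valMinAbs : ℤ) : ℝ) ^ 2))⁻¹ ^ 4) := by
  wlog hle : Real.sqrt (∑ μ, (((u μ).valMinAbs : ℤ) : ℝ) ^ 2) ≤
      Real.sqrt (∑ μ, (((v μ).valMinAbs : ℤ) : ℝ) ^ 2) generalizing u v
  · have h := this v u (by rwa [add_comm]) (le_of_not_ge hle)
    rw [add_comm v u] at h
    linarith
  set du := (Real.sqrt (∑ μ, (((u μ).valMinAbs : ℤ) : ℝ) ^ 2))⁻¹
  set dv := (Real.sqrt (∑ μ, (((v μ).valMinAbs : ℤ) : ℝ) ^ 2))⁻¹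
  set dw := (Real.sqrt (∑ μ, ((((u + v) μ).valMinAbs : ℤ) : ℝ) ^ 2))⁻¹
  have hdu0 : 0 ≤ du := inv_nonneg.2 (Real.sqrt_nonneg _)
  have hdv0 : 0 ≤ dv := inv_nonneg.2 (Real.sqrt_nonneg _)
  have h2 : dv ^ 4 ≤ (2 * dw) ^ 4 :=
    pow_le_pow_left₀ hdv0 (inv_torusDist_le_two_mul_inv_add u v huv hle) 4
  calc du ^ 4 * dv ^ 4 ≤ du ^ 4 * (2 * dw) ^ 4 := mul_le_mul_of_nonneg_left h2 (pow_nonneg hdu0 4)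
    _ = 16 * dw ^ 4 * du ^ 4 := by ring
    _ ≤ 16 * dw ^ 4 * (du ^ 4 + dv ^ 4) := by
        gcongr
        exact le_add_of_nonneg_right (pow_nonneg hdv0 4)

/-! ### Abstract lattice bookkeeping -/

/-- Reindexing a sum over lattice points by their (injective, nonzero) torus differences. [folklore] -/
theorem sum_torusDiff_le_sum_univ_erase_zero {α T : Type*} [DecidableEq α] [AddCommGroup T]
    [Fintype T] [DecidableEq T] (B T0 : Finset α) (hT0 : T0 ⊆ B) (p : α → T)
    (hp : ∀ x ∈ B, ∀ y ∈ B, x ≠ y → p x - p y ≠ 0) {c : α} (hc : c ∈ B) (hcT : c ∉ T0)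
    (ρ : T → ℝ) (hρ0 : ∀ w, 0 ≤ ρ w) :
    ∑ z ∈ T0, ρ (p z - p c) ≤ ∑ w ∈ (Finset.univ : Finset T).erase 0, ρ w := by
  have hinj : Set.InjOn (fun z => p z - p c) ↑T0 := by
    intro z hz z' hz' h
    by_contra hne
    have h2 : p z - p c = p z' - p c := h
    rw [sub_left_inj] at h2
    have h' : p z - p z' = 0 := by rw [h2, sub_self]
    exact hp z (hT0 (Finset.mem_coe.1 hz)) z' (hT0 (Finset.mem_coe.1 hz')) hne h'
  calc ∑ z ∈ T0, ρ (p z - p c) = ∑ w ∈ T0.image (fun z => p z - p c), ρ w :=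
        (Finset.sum_image hinj).symm
    _ ≤ ∑ w ∈ (Finset.univ : Finset T).erase 0, ρ w := by
        refine Finset.sum_le_sum_of_subset_of_nonneg ?_ fun w _ _ => hρ0 w
        intro w hw
        rw [Finset.mem_image] at hw
        obtain ⟨z, hz, rfl⟩ := hw
        exact Finset.mem_erase.2 ⟨hp z (hT0 hz) c hc (fun h => hcT (h ▸ hz)), Finset.mem_univ _⟩

/-- **The sum over the third point**: `∑_{z≠x,y} c(z) ρ(ȳ-z̄) ρ(z̄-x̄) ≤ 32 M (∑_{w≠0} ρ) ρ(x̄-ȳ)`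
for weights `c ≤ M` and an even kernel `ρ ≥ 0` with `ρ(u) ρ(v) ≤ 16 ρ(u+v) (ρ(u) + ρ(v))`.
[folklore] -/
theorem ringSmearing_third_point_sum_le {α T : Type*} [DecidableEq α] [AddCommGroup T] [Fintype T]
    [DecidableEq T] (B : Finset α) (p : α → T) (hp : ∀ x ∈ B, ∀ y ∈ B, x ≠ y → p x - p y ≠ 0)
    (ρ : T → ℝ) (hρ0 : ∀ w, 0 ≤ ρ w) (hρneg : ∀ w, ρ (-w) = ρ w)
    (hρkey : ∀ u v, u + v ≠ 0 → ρ u * ρ v ≤ 16 * ρ (u + v) * (ρ u + ρ v))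
    (c : α → ℝ) {M : ℝ} (hM0 : 0 ≤ M) (hcM : ∀ z, c z ≤ M)
    {x y : α} (hx : x ∈ B) (hy : y ∈ B) (hxy : x ≠ y) :
    ∑ z ∈ (B.erase x).erase y, c z * ρ (p y - p z) * ρ (p z - p x) ≤
      32 * M * (∑ w ∈ (Finset.univ : Finset T).erase 0, ρ w) * ρ (p x - p y) := by
  set TT := ∑ w ∈ (Finset.univ : Finset T).erase 0, ρ w
  have hsub : (B.erase x).erase y ⊆ B := (Finset.erase_subset _ _).trans (Finset.erase_subset _ _)
  have hxn : x ∉ (B.erase x).erase y := fun h => by simp at h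
  have hyn : y ∉ (B.erase x).erase y := fun h => by simp at h
  have hyx : ρ (p y - p x) = ρ (p x - p y) := by rw [← neg_sub, hρneg]
  have hpt : ∀ z ∈ (B.erase x).erase y, c z * ρ (p y - p z) * ρ (p z - p x) ≤
      16 * M * ρ (p x - p y) * (ρ (p z - p y) + ρ (p z - p x)) := by
    intro z _
    have hne : p y - p z + (p z - p x) ≠ 0 := by
      rw [sub_add_sub_cancel]; exact hp y hy x hx (Ne.symm hxy)
    have hk := hρkey (p y - p z) (p z - p x) hne
    rw [sub_add_sub_cancel, hyx] at hk
    have hzy : ρ (p y - p z) = ρ (p z - p y) := by rw [← neg_sub, hρneg]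
    calc c z * ρ (p y - p z) * ρ (p z - p x) = c z * (ρ (p y - p z) * ρ (p z - p x)) := by ring
      _ ≤ M * (16 * ρ (p x - p y) * (ρ (p y - p z) + ρ (p z - p x))) :=
          mul_le_mul (hcM z) hk (mul_nonneg (hρ0 _) (hρ0 _)) hM0
      _ = 16 * M * ρ (p x - p y) * (ρ (p z - p y) + ρ (p z - p x)) := by rw [hzy]; ring
  have hs1 : ∑ z ∈ (B.erase x).erase y, ρ (p z - p y) ≤ TT :=
    sum_torusDiff_le_sum_univ_erase_zero B _ hsub p hp hy hyn ρ hρ0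
  have hs2 : ∑ z ∈ (B.erase x).erase y, ρ (p z - p x) ≤ TT :=
    sum_torusDiff_le_sum_univ_erase_zero B _ hsub p hp hx hxn ρ hρ0
  have h16 : 0 ≤ 16 * M * ρ (p x - p y) := mul_nonneg (mul_nonneg (by norm_num) hM0) (hρ0 _)
  calc ∑ z ∈ (B.erase x).erase y, c z * ρ (p y - p z) * ρ (p z - p x)
      ≤ ∑ z ∈ (B.erase x).erase y, 16 * M * ρ (p x - p y) * (ρ (p z - p y) + ρ (p z - p x)) :=
        Finset.sum_le_sum hpt
    _ = 16 * M * ρ (p x - p y) * (∑ z ∈ (B.erase x).erase y, ρ (p z - p y) +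
          ∑ z ∈ (B.erase x).erase y, ρ (p z - p x)) := by
        rw [← Finset.sum_add_distrib, Finset.mul_sum]
    _ ≤ 16 * M * ρ (p x - p y) * (TT + TT) := mul_le_mul_of_nonneg_left (add_le_add hs1 hs2) h16
    _ = 32 * M * TT * ρ (p x - p y) := by ring

/-- **One group of the ring bound, abstractly.** With `r` an even nonnegative kernel on the torus whose
fourth power satisfies the key inequality of `torusDist_inv_pow_four_mul_le`, nonnegative weights
`F` and `G ≤ M_G`, `H ≤ M_H`, the pair sum `∑∑ F G r⁹ ≤ A` and `T := ∑_{w ≠ 0} r⁴`: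
`∑_x ∑_{y≠x} ∑_{z≠x,y} F(x) G(y) H(z) (r(x̄-ȳ)⁵ + E) r(ȳ-z̄)⁴ r(z̄-x̄)⁴ ≤ 32 M_H T A + 32 M_H T² E M_G ∑F`.
[folklore] -/
theorem ringSmearing_group_sum_le {α T : Type*} [DecidableEq α] [AddCommGroup T] [Fintype T]
    [DecidableEq T] (B : Finset α) (p : α → T) (hp : ∀ x ∈ B, ∀ y ∈ B, x ≠ y → p x - p y ≠ 0)
    (r : T → ℝ) (hr0 : ∀ w, 0 ≤ r w) (hrneg : ∀ w, r (-w) = r w)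
    (hrkey : ∀ u v, u + v ≠ 0 → r u ^ 4 * r v ^ 4 ≤ 16 * r (u + v) ^ 4 * (r u ^ 4 + r v ^ 4))
    (F G Hc : α → ℝ) (hF0 : ∀ x, 0 ≤ F x) (hG0 : ∀ x, 0 ≤ G x)
    {MG MH SF E A : ℝ} (hMG0 : 0 ≤ MG) (hMH0 : 0 ≤ MH) (hGM : ∀ x, G x ≤ MG)
    (hHM : ∀ x, Hc x ≤ MH) (hSF : ∑ x ∈ B, F x ≤ SF) (hE : 0 ≤ E)
    (hA : ∑ x ∈ B, ∑ y ∈ B.erase x, F x * G y * r (p x - p y) ^ 9 ≤ A) :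
    ∑ x ∈ B, ∑ y ∈ B.erase x, ∑ z ∈ (B.erase x).erase y,
        F x * G y * Hc z * ((r (p x - p y) ^ 5 + E) * r (p y - p z) ^ 4 * r (p z - p x) ^ 4) ≤
      32 * MH * (∑ w ∈ (Finset.univ : Finset T).erase 0, r w ^ 4) * A +
        32 * MH * (∑ w ∈ (Finset.univ : Finset T).erase 0, r w ^ 4) ^ 2 * E * MG * SF := by
  set TT := ∑ w ∈ (Finset.univ : Finset T).erase 0, r w ^ 4
  have hTT0 : 0 ≤ TT := Finset.sum_nonneg fun w _ => pow_nonneg (hr0 w) 4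
  have hρneg : ∀ w, r (-w) ^ 4 = r w ^ 4 := fun w => by rw [hrneg]
  have hρ0 : ∀ w, 0 ≤ r w ^ 4 := fun w => pow_nonneg (hr0 w) 4
  have hinner : ∀ x ∈ B, ∀ y ∈ B.erase x,
      ∑ z ∈ (B.erase x).erase y, Hc z * r (p y - p z) ^ 4 * r (p z - p x) ^ 4 ≤
        32 * MH * TT * r (p x - p y) ^ 4 := by
    intro x hx y hy
    obtain ⟨hyx, hyB⟩ := Finset.mem_erase.1 hy
    exact ringSmearing_third_point_sum_le B p hp (fun w => r w ^ 4) hρ0 hρneg hrkey Hc hMH0 hHM hx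
      hyB (Ne.symm hyx)
  have hpair : ∀ x ∈ B, ∑ y ∈ B.erase x, G y * r (p x - p y) ^ 4 ≤ MG * TT := by
    intro x hx
    calc ∑ y ∈ B.erase x, G y * r (p x - p y) ^ 4
        ≤ ∑ y ∈ B.erase x, MG * r (p y - p x) ^ 4 := by
          refine Finset.sum_le_sum fun y _ => ?_
          have hxy : r (p x - p y) ^ 4 = r (p y - p x) ^ 4 := by rw [← neg_sub, hρneg]
          rw [hxy]
          exact mul_le_mul_of_nonneg_right (hGM y) (hρ0 _)
      _ = MG * ∑ y ∈ B.erase x, r (p y - p x) ^ 4 := by rw [Finset.mul_sum]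
      _ ≤ MG * TT := mul_le_mul_of_nonneg_left
          (sum_torusDiff_le_sum_univ_erase_zero B (B.erase x) (Finset.erase_subset _ _) p hp hx
            (Finset.notMem_erase x B) (fun w => r w ^ 4) hρ0) hMG0
  have h32 : 0 ≤ 32 * MH * TT := by positivity
  calc ∑ x ∈ B, ∑ y ∈ B.erase x, ∑ z ∈ (B.erase x).erase y,
        F x * G y * Hc z * ((r (p x - p y) ^ 5 + E) * r (p y - p z) ^ 4 * r (p z - p x) ^ 4)
      = ∑ x ∈ B, ∑ y ∈ B.erase x, (F x * G y * (r (p x - p y) ^ 5 + E)) *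
          ∑ z ∈ (B.erase x).erase y, Hc z * r (p y - p z) ^ 4 * r (p z - p x) ^ 4 := by
        refine Finset.sum_congr rfl fun x _ => Finset.sum_congr rfl fun y _ => ?_
        rw [Finset.mul_sum]
        exact Finset.sum_congr rfl fun z _ => by ring
    _ ≤ ∑ x ∈ B, ∑ y ∈ B.erase x, (F x * G y * (r (p x - p y) ^ 5 + E)) *
          (32 * MH * TT * r (p x - p y) ^ 4) := by
        refine Finset.sum_le_sum fun x hx => Finset.sum_le_sum fun y hy => ?_
        exact mul_le_mul_of_nonneg_left (hinner x hx y hy)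
          (mul_nonneg (mul_nonneg (hF0 x) (hG0 y)) (add_nonneg (pow_nonneg (hr0 _) 5) hE))
    _ = ∑ x ∈ B, (32 * MH * TT * ∑ y ∈ B.erase x, F x * G y * r (p x - p y) ^ 9 +
          32 * MH * TT * E * (F x * ∑ y ∈ B.erase x, G y * r (p x - p y) ^ 4)) := by
        refine Finset.sum_congr rfl fun x _ => ?_
        calc ∑ y ∈ B.erase x, F x * G y * (r (p x - p y) ^ 5 + E) * (32 * MH * TT * r (p x - p y) ^ 4)
            = ∑ y ∈ B.erase x, (32 * MH * TT * (F x * G y * r (p x - p y) ^ 9) +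
                32 * MH * TT * E * (F x * (G y * r (p x - p y) ^ 4))) :=
              Finset.sum_congr rfl fun y _ => by ring
          _ = _ := by
              rw [Finset.sum_add_distrib, ← Finset.mul_sum, ← Finset.mul_sum, ← Finset.mul_sum]
    _ = 32 * MH * TT * (∑ x ∈ B, ∑ y ∈ B.erase x, F x * G y * r (p x - p y) ^ 9) +
          32 * MH * TT * E * (∑ x ∈ B, F x * ∑ y ∈ B.erase x, G y * r (p x - p y) ^ 4) := by
        rw [Finset.sum_add_distrib, ← Finset.mul_sum, ← Finset.mul_sum]
    _ ≤ 32 * MH * TT * A + 32 * MH * TT * E * (∑ x ∈ B, F x * (MG * TT)) := by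
        have h1 : ∑ x ∈ B, F x * ∑ y ∈ B.erase x, G y * r (p x - p y) ^ 4 ≤
            ∑ x ∈ B, F x * (MG * TT) :=
          Finset.sum_le_sum fun x hx => mul_le_mul_of_nonneg_left (hpair x hx) (hF0 x)
        have := mul_le_mul_of_nonneg_left hA h32
        have := mul_le_mul_of_nonneg_left h1 (mul_nonneg h32 hE)
        linarith
    _ = 32 * MH * TT * A + 32 * MH * TT ^ 2 * E * MG * ∑ x ∈ B, F x := by
        rw [← Finset.sum_mul]; ring
    _ ≤ 32 * MH * TT * A + 32 * MH * TT ^ 2 * E * MG * SF := by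
        have h0 : 0 ≤ 32 * MH * TT ^ 2 * E * MG := by positivity
        have := mul_le_mul_of_nonneg_left hSF h0
        linarith

/-- **Numerical bookkeeping** for one group: with `T ≤ C_T (1 + log(2L+1))`, `a² L = 1` and
`0 < a ≤ 1` (so `2L+1 ≥ 2a⁻²` and `1 + log(2L+1) ≤ 2L+1`), the bound
`32 M_χ T (C a) + 32 M_χ T² (2L+1)⁻⁴ M_ψ (C_φ · 256 a⁻⁴)` is `≤ K a (1 + log(2L+1))`. [folklore] -/
theorem ringSmearing_group_numerics {Mχ Mψ Cφ Cφψ CT TT a : ℝ} {L : ℕ} (hMχ : 0 ≤ Mχ)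
    (hMψ : 0 ≤ Mψ) (hCφ : 0 ≤ Cφ) (hCφψ : 0 ≤ Cφψ) (hTT0 : 0 ≤ TT) (ha : 0 < a) (ha1 : a ≤ 1)
    (hL : a ^ 2 * (L : ℝ) = 1) (hTT : TT ≤ CT * (1 + Real.log (2 * L + 1))) :
    32 * Mχ * TT * (Cφψ * a) +
        32 * Mχ * TT ^ 2 * ((((2 * L + 1 : ℕ)) : ℝ) ^ 4)⁻¹ * Mψ * (Cφ * (256 * a⁻¹ ^ 4)) ≤
      (32 * Mχ * CT * Cφψ + 1024 * Mχ * Mψ * Cφ * CT ^ 2) * a * (1 + Real.log (2 * L + 1)) := by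
  set ℓ := 1 + Real.log (2 * L + 1)
  set S : ℝ := 2 * L + 1 with hS
  have hScast : (((2 * L + 1 : ℕ)) : ℝ) = S := by rw [hS]; push_cast; ring
  rw [hScast]
  have hL0 : (0 : ℝ) ≤ L := Nat.cast_nonneg L
  have hS1 : 1 ≤ S := by rw [hS]; linarith
  have hS0 : 0 < S := by linarith
  have hℓ0 : 0 ≤ ℓ := by linarith [Real.log_nonneg hS1]
  have hℓS : ℓ ≤ S := by linarith [Real.log_le_sub_one_of_pos hS0]
  have hSinv : S⁻¹ ≤ a ^ 2 / 2 := by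
    rw [inv_le_iff_one_le_mul₀ hS0, hS]; nlinarith [sq_nonneg a]
  have hE0 : 0 ≤ (S ^ 4)⁻¹ := by positivity
  have hℓE : ℓ * (S ^ 4)⁻¹ ≤ a ^ 6 / 8 := by
    calc ℓ * (S ^ 4)⁻¹ ≤ S * (S ^ 4)⁻¹ := mul_le_mul_of_nonneg_right hℓS hE0
      _ = (S⁻¹) ^ 3 := by field_simp
      _ ≤ (a ^ 2 / 2) ^ 3 := pow_le_pow_left₀ (inv_nonneg.2 hS0.le) hSinv 3
      _ = a ^ 6 / 8 := by ring
  have hkey : ℓ ^ 2 * (S ^ 4)⁻¹ * a⁻¹ ^ 4 ≤ ℓ * a / 8 := by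
    have hai : 0 ≤ a⁻¹ ^ 4 := by positivity
    calc ℓ ^ 2 * (S ^ 4)⁻¹ * a⁻¹ ^ 4 = ℓ * (ℓ * (S ^ 4)⁻¹) * a⁻¹ ^ 4 := by ring
      _ ≤ ℓ * (a ^ 6 / 8) * a⁻¹ ^ 4 :=
          mul_le_mul_of_nonneg_right (mul_le_mul_of_nonneg_left hℓE hℓ0) hai
      _ = ℓ * a ^ 2 / 8 := by field_simp
      _ ≤ ℓ * a / 8 := by
          have := mul_le_mul_of_nonneg_left (show a ^ 2 ≤ a by nlinarith) hℓ0
          linarith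
  have hTT2 : TT ^ 2 ≤ (CT * ℓ) ^ 2 := pow_le_pow_left₀ hTT0 hTT 2
  have hc1 : 0 ≤ 32 * Mχ * Cφψ * a := by positivity
  have hc2 : 0 ≤ 8192 * Mχ * Mψ * Cφ := by positivity
  have hc3 : 0 ≤ (S ^ 4)⁻¹ * a⁻¹ ^ 4 := by positivity
  have hc4 : 0 ≤ 8192 * Mχ * Mψ * Cφ * CT ^ 2 := by positivity
  calc 32 * Mχ * TT * (Cφψ * a) + 32 * Mχ * TT ^ 2 * (S ^ 4)⁻¹ * Mψ * (Cφ * (256 * a⁻¹ ^ 4))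
      = 32 * Mχ * Cφψ * a * TT + 8192 * Mχ * Mψ * Cφ * (TT ^ 2 * ((S ^ 4)⁻¹ * a⁻¹ ^ 4)) := by
        ring
    _ ≤ 32 * Mχ * Cφψ * a * (CT * ℓ) +
          8192 * Mχ * Mψ * Cφ * ((CT * ℓ) ^ 2 * ((S ^ 4)⁻¹ * a⁻¹ ^ 4)) := by
        have h1 := mul_le_mul_of_nonneg_left hTT hc1
        have h2 := mul_le_mul_of_nonneg_left (mul_le_mul_of_nonneg_right hTT2 hc3) hc2
        linarith
    _ = 32 * Mχ * CT * Cφψ * a * ℓ +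
          8192 * Mχ * Mψ * Cφ * CT ^ 2 * (ℓ ^ 2 * (S ^ 4)⁻¹ * a⁻¹ ^ 4) := by ring
    _ ≤ 32 * Mχ * CT * Cφψ * a * ℓ + 8192 * Mχ * Mψ * Cφ * CT ^ 2 * (ℓ * a / 8) := by
        have := mul_le_mul_of_nonneg_left hkey hc4
        linarith
    _ = (32 * Mχ * CT * Cφψ + 1024 * Mχ * Mψ * Cφ * CT ^ 2) * a * ℓ := by ring

/-! ### One group of the smeared ring, concretely -/

/-- **One group of the smeared odd ring** (helper stub for `stub_ringSmearingBound`). For Schwartz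
`φ, ψ, χ` on `ℝ⁴` with `φ, ψ` disjointly supported, `0 < a ≤ 1`, `a² L = 1`, the torus of side
`2L+1` with distance `d`, and `x̄ = Torus.proj (2L+1) x`:
`∑_x ∑_{y≠x} ∑_{z≠x,y} |φ(ax)| |ψ(ay)| |χ(az)| (d(x̄-ȳ)⁻⁵ + (2L+1)⁻⁴) d(ȳ-z̄)⁻⁴ d(z̄-x̄)⁻⁴ ≤ K a (1 + log(2L+1))`.
The sum over `z` costs `32 ‖χ‖_∞ (∑_{w≠0} d⁻⁴) d(x̄-ȳ)⁻⁴` (`ringSmearing_third_point_sum_le` with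
`torusDist_inv_pow_four_mul_le`; `∑_{w≠0} d⁻⁴ = O(log L)` by `stub_torusLatticeSums`), leaving the
flat pair sum with `d⁻⁹ = O(a)` (`stub_flatPairSum`) and the zero-mode term
`(2L+1)⁻⁴ · O(a⁻⁴ log² L) = O(a⁴ log² L) = O(a log L)`. [folklore] -/
theorem ringSmearing_group_bound (φ ψ χ : SchwartzMap (EuclideanSpace ℝ (Fin 4)) ℝ)
    (hφψ : Disjoint (tsupport φ) (tsupport ψ)) :
    ∃ K : ℝ, ∀ (a : ℝ), 0 < a → a ≤ 1 → ∀ (L : ℕ), a ^ 2 * (L : ℝ) = 1 →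
      ∑ x ∈ box 4 L, ∑ y ∈ (box 4 L).erase x, ∑ z ∈ ((box 4 L).erase x).erase y,
        |φ (a • siteToE x)| * |ψ (a • siteToE y)| * |χ (a • siteToE z)| *
          (((Real.sqrt (∑ μ, ((((Torus.proj (2 * L + 1) x - Torus.proj (2 * L + 1) y) μ).valMinAbs
              : ℤ) : ℝ) ^ 2))⁻¹ ^ 5 + (((2 * L + 1 : ℕ) : ℝ) ^ 4)⁻¹) *
            (Real.sqrt (∑ μ, ((((Torus.proj (2 * L + 1) y - Torus.proj (2 * L + 1) z) μ).valMinAbs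
              : ℤ) : ℝ) ^ 2))⁻¹ ^ 4 *
            (Real.sqrt (∑ μ, ((((Torus.proj (2 * L + 1) z - Torus.proj (2 * L + 1) x) μ).valMinAbs
              : ℤ) : ℝ) ^ 2))⁻¹ ^ 4) ≤
        K * a * (1 + Real.log (2 * L + 1)) := by
  obtain ⟨CT, hCT⟩ := stub_torusLatticeSums
  obtain ⟨Cφψ, hCφψ⟩ := stub_flatPairSum φ ψ hφψ
  obtain ⟨Cφ, hCφ0, hCφ⟩ := schwartz_abs_le_inv_pow φ
  obtain ⟨Mψ, hMψ0, hMψ⟩ := schwartz_abs_le_inv_pow ψ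
  obtain ⟨Mχ, hMχ0, hMχ⟩ := schwartz_abs_le_inv_pow χ
  have hCφψ0 : 0 ≤ Cφψ := by
    have h1 := hCφψ 1 one_pos le_rfl 1 (by norm_num)
    have h0 : (0 : ℝ) ≤ Cφψ * 1 :=
      le_trans (Finset.sum_nonneg fun x _ => Finset.sum_nonneg fun y _ => by positivity) h1
    linarith
  refine ⟨32 * Mχ * CT * Cφψ + 1024 * Mχ * Mψ * Cφ * CT ^ 2, ?_⟩
  intro a ha ha1 L hL
  have hsup : ∀ (θ : SchwartzMap (EuclideanSpace ℝ (Fin 4)) ℝ) (M : ℝ), 0 ≤ M →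
      (∀ X, |θ X| ≤ M * ((1 + ‖X‖) ^ 17)⁻¹) → ∀ X, |θ X| ≤ M := by
    intro θ M hM0 hM X
    refine (hM X).trans (mul_le_of_le_one_right hM0 (inv_le_one_of_one_le₀ ?_))
    exact one_le_pow₀ (by linarith [norm_nonneg X])
  have hSF : ∑ x ∈ box 4 L, |φ (a • siteToE x)| ≤ Cφ * (256 * a⁻¹ ^ 4) := by
    calc ∑ x ∈ box 4 L, |φ (a • siteToE x)|
        ≤ ∑ x ∈ box 4 L, Cφ * ((1 + ‖a • siteToE x‖) ^ 8)⁻¹ := by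
          refine Finset.sum_le_sum fun x _ => (hCφ _).trans ?_
          refine mul_le_mul_of_nonneg_left ?_ hCφ0
          apply inv_anti₀ (by positivity)
          exact pow_le_pow_right₀ (by linarith [norm_nonneg (a • siteToE x)]) (by norm_num)
      _ = Cφ * ∑ x ∈ box 4 L, ((1 + ‖a • siteToE x‖) ^ 8)⁻¹ := by rw [Finset.mul_sum]
      _ ≤ Cφ * (256 * a⁻¹ ^ 4) := mul_le_mul_of_nonneg_left (sum_box_weight_le ha ha1 L) hCφ0
  have hT := (hCT (2 * L + 1)).1
  have hScast : (((2 * L + 1 : ℕ)) : ℝ) = 2 * (L : ℝ) + 1 := by push_cast; ring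
  rw [hScast] at hT
  have hmain := ringSmearing_group_sum_le (box 4 L) (Torus.proj (2 * L + 1))
    (fun x hx y hy hxy => proj_sub_proj_ne_zero_of_mem_box hx hy hxy)
    (fun w : TorusSite 4 (2 * L + 1) => (Real.sqrt (∑ μ, (((w μ).valMinAbs : ℤ) : ℝ) ^ 2))⁻¹)
    (fun w => inv_nonneg.2 (Real.sqrt_nonneg _))
    (fun w => by show (Real.sqrt _)⁻¹ = (Real.sqrt _)⁻¹; rw [sqrt_sum_sq_valMinAbs_neg])
    (fun u v huv => torusDist_inv_pow_four_mul_le u v huv)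
    (fun x => |φ (a • siteToE x)|) (fun x => |ψ (a • siteToE x)|) (fun x => |χ (a • siteToE x)|)
    (fun x => abs_nonneg _) (fun x => abs_nonneg _) hMψ0 hMχ0
    (fun x => hsup ψ Mψ hMψ0 hMψ _) (fun x => hsup χ Mχ hMχ0 hMχ _)
    hSF (E := (((2 * L + 1 : ℕ) : ℝ) ^ 4)⁻¹) (by positivity) (hCφψ a ha ha1 L hL.symm.le)
  beta_reduce at hmain
  exact hmain.trans (ringSmearing_group_numerics hMχ0 hMψ0 hCφ0 hCφψ0
    (Finset.sum_nonneg fun w _ => by positivity) ha ha1 hL hT)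

end Summit.QuantumFields.YangMills.Theorems.SelfNormalisedSkewness.Negative

end
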